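import Literature.Computability.AlgebraicComplexity.WeightedEntropyMax
import HarnessLib

/-!
# Entropy tools for Strassen's support functionals: Gibbs' inequality, weak duality, push-forwards

Topic `Literature/Computability/AlgebraicComplexity`. Elementary facts about the quantities of
`QuantumFunctionals.lean` — `shannonEntropy` (`H`, in bits), `weightedEntropy θ P = H_θ(P) = ∑ θᵢ H(Pᵢ)`
and `maxWeightedEntropy θ Φ = H_θ(Φ) = max_{P ∈ P(Φ)} H_θ(P)` (CVZ 2023, Def. 2.2) — that are used to
bound Strassen's upper support functionals from above (by dual certificates) and from below (by
transporting distributions along coordinatewise injections), as in the proofs of [Str91, §2–4] and of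
CVZ 2023, Prop. 2.16 / Thm. 2.15, and in the numerical evaluation of CLLZ 2025, §4.3–4.4.

## Content (all proved, no definitions)

* `weightedEntropy_le_of_cost_le`, `maxWeightedEntropy_le_of_cost_le` — **weak duality** for `H_θ`
  (on top of Gibbs' inequality `weightedEntropy_le_sum_mul_score` of `WeightedEntropyMax.lean`): if
  `Q₁, Q₂, Q₃ > 0` are sub-probability vectors on the three index sets and the cost
  `c(x) = ∑ᵢ θᵢ log₂(1/Qᵢ(xᵢ))` is `≤ V` on `Φ`, then `H_θ(Φ) ≤ V` (`θ ≥ 0`, `V ≥ 0`).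
* `maxWeightedEntropy_mono` (`Φ ⊆ Ψ ⇒ H_θ(Φ) ≤ H_θ(Ψ)`).
* `negMulLog_sum_eq_sum_of_subsingleton`, `shannonEntropy_fiberSum_eq` — the entropy of a push-forward
  along a map injective on the support equals the entropy.
* `maxWeightedEntropy_le_of_injOn` — **transport**: if `φ₁ × φ₂ × φ₃` maps `Φ` into `Ψ` and each `φᵢ`
  is injective on the `i`-th projection of `Φ`, then `H_θ(Φ) ≤ H_θ(Ψ)` (the step "`H_θ(P) = H_θ(Q)`"
  closing the proof of CVZ 2023, Thm. 2.15).

## References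

* V. Strassen, *Degeneration and complexity of bilinear maps: some asymptotic spectra*, J. reine
  angew. Math. 413 (1991) — cited through CVZ.
* M. Christandl, P. Vrana, J. Zuiddam, *Universal points in the asymptotic spectrum of tensors*,
  J. Amer. Math. Soc. 36 (2023), §2 (Def. 2.2, Prop. 2.16, Thm. 2.15). [ChristandlVranaZuiddam2023]
* M. Christandl, F. Le Gall, V. Lysikov, J. Zuiddam, *Barriers for rectangular matrix
  multiplication*, comput. complexity 34 (2025), §4.3–4.4. [ChristandlLeGallLysikovZuiddam2025]
-/

noncomputable section

open scoped BigOperators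
open Real (negMulLog)

namespace Literature.Computability.AlgebraicComplexity

/-! ## Weak duality for the `θ`-weighted marginal entropy -/

section Duality

variable {ι κ μ : Type*} [Fintype ι] [Fintype κ] [Fintype μ]

/-- **Weak duality, bound form**: for `θ ≥ 0`, positive sub-probability vectors `Q₁, Q₂, Q₃` on the
three index sets and a probability distribution `P` on `ι × κ × μ`, if the cost
`c(x) = θ₀ log₂(1/Q₁(x₁)) + θ₁ log₂(1/Q₂(x₂)) + θ₂ log₂(1/Q₃(x₃))` is `≤ V` wherever `P` is nonzero, then
`H_θ(P) ≤ V` (Gibbs' inequality for each marginal, `weightedEntropy_le_sum_mul_score`, and `∑ P = 1`).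
This is the easy direction of the convex duality used to evaluate Strassen's support functionals
(CLLZ §4.3–4.4). [folklore] -/
theorem weightedEntropy_le_of_cost_le {θ : Fin 3 → ℝ} (hθ : ∀ i, 0 ≤ θ i) {Q₁ : ι → ℝ} {Q₂ : κ → ℝ}
    {Q₃ : μ → ℝ} (hQ₁ : ∀ a, 0 < Q₁ a) (hQ₁' : ∑ a, Q₁ a ≤ 1) (hQ₂ : ∀ b, 0 < Q₂ b)
    (hQ₂' : ∑ b, Q₂ b ≤ 1) (hQ₃ : ∀ c, 0 < Q₃ c) (hQ₃' : ∑ c, Q₃ c ≤ 1) {P : ι × κ × μ → ℝ}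
    (hP : P ∈ stdSimplex ℝ (ι × κ × μ)) {V : ℝ}
    (hV : ∀ x, P x ≠ 0 → θ 0 * (-Real.log (Q₁ x.1) / Real.log 2) +
      θ 1 * (-Real.log (Q₂ x.2.1) / Real.log 2) + θ 2 * (-Real.log (Q₃ x.2.2) / Real.log 2) ≤ V) :
    weightedEntropy θ P ≤ V := by
  refine (weightedEntropy_le_sum_mul_score hθ hP (fun a => (hQ₁ a).le) hQ₁' (fun b => (hQ₂ b).le)
    hQ₂' (fun c => (hQ₃ c).le) hQ₃'
    (fun y _ => ⟨fun _ => hQ₁ _, fun _ => hQ₂ _, fun _ => hQ₃ _⟩)).trans ?_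
  calc ∑ x, P x * (θ 0 * (-Real.log (Q₁ x.1) / Real.log 2) +
        θ 1 * (-Real.log (Q₂ x.2.1) / Real.log 2) + θ 2 * (-Real.log (Q₃ x.2.2) / Real.log 2))
      ≤ ∑ x, P x * V := by
        refine Finset.sum_le_sum fun x _ => ?_
        by_cases hx : P x = 0
        · simp [hx]
        · exact mul_le_mul_of_nonneg_left (hV x hx) (hP.1 x)
    _ = V := by rw [← Finset.sum_mul, hP.2, one_mul]

/-- **Weak duality for `H_θ(Φ)`** (CVZ Def. 2.2): if the cost of three positive sub-probability vectors
is `≤ V` on `Φ` and `V ≥ 0`, then `H_θ(Φ) = max_{P ∈ P(Φ)} H_θ(P) ≤ V` (`θ ≥ 0`; the hypothesis `V ≥ 0`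
covers the junk value `H_θ(∅) = 0`). [folklore] -/
theorem maxWeightedEntropy_le_of_cost_le {θ : Fin 3 → ℝ} (hθ : ∀ i, 0 ≤ θ i) {Q₁ : ι → ℝ} {Q₂ : κ → ℝ}
    {Q₃ : μ → ℝ} (hQ₁ : ∀ a, 0 < Q₁ a) (hQ₁' : ∑ a, Q₁ a ≤ 1) (hQ₂ : ∀ b, 0 < Q₂ b)
    (hQ₂' : ∑ b, Q₂ b ≤ 1) (hQ₃ : ∀ c, 0 < Q₃ c) (hQ₃' : ∑ c, Q₃ c ≤ 1) {Φ : Set (ι × κ × μ)}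
    {V : ℝ} (hV0 : 0 ≤ V)
    (hV : ∀ x ∈ Φ, θ 0 * (-Real.log (Q₁ x.1) / Real.log 2) +
      θ 1 * (-Real.log (Q₂ x.2.1) / Real.log 2) + θ 2 * (-Real.log (Q₃ x.2.2) / Real.log 2) ≤ V) :
    maxWeightedEntropy θ Φ ≤ V := by
  refine Real.sSup_le ?_ hV0
  rintro _ ⟨P, ⟨hP, hsupp⟩, rfl⟩
  exact weightedEntropy_le_of_cost_le hθ hQ₁ hQ₁' hQ₂ hQ₂' hQ₃ hQ₃' hP fun x hx => hV x (hsupp hx)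

/-- `H_θ` is monotone in the support set: `Φ ⊆ Ψ ⇒ H_θ(Φ) ≤ H_θ(Ψ)` (`θ ≥ 0`). [folklore] -/
theorem maxWeightedEntropy_mono {θ : Fin 3 → ℝ} (hθ : ∀ i, 0 ≤ θ i) {Φ Ψ : Set (ι × κ × μ)}
    (h : Φ ⊆ Ψ) : maxWeightedEntropy θ Φ ≤ maxWeightedEntropy θ Ψ := by
  refine Real.sSup_le ?_ (maxWeightedEntropy_nonneg hθ Ψ)
  rintro _ ⟨P, ⟨hP, hsupp⟩, rfl⟩
  exact weightedEntropy_le_maxWeightedEntropy hθ hP (hsupp.trans h)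

end Duality

/-! ## Entropy of push-forwards along maps injective on the support -/

section Pushforward

variable {α β : Type*}

/-- If at most one term of a finite family is nonzero, then `−u log u` of the sum is the sum of the
`−u log u` (both sides reduce to the single possibly nonzero term). [folklore] -/
theorem negMulLog_sum_eq_sum_of_subsingleton (s : Finset α) (w : α → ℝ)
    (h : ∀ a ∈ s, ∀ b ∈ s, w a ≠ 0 → w b ≠ 0 → a = b) :
    negMulLog (∑ a ∈ s, w a) = ∑ a ∈ s, negMulLog (w a) := by
  by_cases hex : ∃ a ∈ s, w a ≠ 0
  · obtain ⟨a, ha, hwa⟩ := hex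
    have hz : ∀ b ∈ s, b ≠ a → w b = 0 := fun b hb hba => by
      by_contra hwb
      exact hba (h b hb a ha hwb hwa)
    rw [Finset.sum_eq_single a (fun b hb hba => hz b hb hba) (fun hna => (hna ha).elim),
      Finset.sum_eq_single a (fun b hb hba => by rw [hz b hb hba, Real.negMulLog_zero])
        (fun hna => (hna ha).elim)]
  · push Not at hex
    rw [Finset.sum_eq_zero hex, Real.negMulLog_zero,
      Finset.sum_eq_zero fun a ha => by rw [hex a ha, Real.negMulLog_zero]]

variable [Fintype α] [Fintype β] [DecidableEq β]

/-- **The entropy of a push-forward along a map injective on the support equals the entropy**: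
for `f : α → β` injective on `{a | P a ≠ 0}`, the distribution `b ↦ ∑_{f a = b} P a` has the same
Shannon entropy as `P`. [folklore] -/
theorem shannonEntropy_fiberSum_eq (P : α → ℝ) (f : α → β) (hf : Set.InjOn f {a | P a ≠ 0}) :
    shannonEntropy (fun b => ∑ a ∈ Finset.univ with f a = b, P a) = shannonEntropy P := by
  simp only [shannonEntropy_def]
  congr 1
  calc ∑ b, negMulLog (∑ a ∈ Finset.univ with f a = b, P a)
      = ∑ b, ∑ a ∈ Finset.univ with f a = b, negMulLog (P a) := by
        refine Finset.sum_congr rfl fun b _ => negMulLog_sum_eq_sum_of_subsingleton _ _ ?_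
        intro a ha a' ha' hwa hwa'
        simp only [Finset.mem_filter, Finset.mem_univ, true_and] at ha ha'
        exact hf hwa hwa' (ha.trans ha'.symm)
    _ = ∑ a, negMulLog (P a) := Finset.sum_fiberwise Finset.univ f fun a => negMulLog (P a)

end Pushforward

/-! ## Transport of `H_θ` along coordinatewise injections -/

section Transport

variable {ι κ μ ι' κ' μ' : Type*} [Fintype ι] [Fintype κ] [Fintype μ] [Fintype ι'] [Fintype κ']
  [Fintype μ'] [DecidableEq ι'] [DecidableEq κ'] [DecidableEq μ']

omit [Fintype ι'] in
/-- Summing an indicator of a triple equation over the last two target coordinates leaves the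
indicator of the first coordinate. [folklore] -/
theorem sum_sum_ite_triple_eq₁ (a₀ : ι') (b₀ : κ') (c₀ : μ') (a' : ι') (r : ℝ) :
    (∑ b' : κ', ∑ c' : μ', if (a₀, b₀, c₀) = (a', b', c') then r else 0) =
      if a₀ = a' then r else 0 := by
  by_cases ha : a₀ = a'
  · simp only [ha, Prod.mk.injEq, true_and, if_true, ite_and, Finset.sum_ite_irrel,
      Finset.sum_ite_eq, Finset.mem_univ, Finset.sum_const_zero]
  · simp [ha]

omit [Fintype κ'] in
/-- Summing an indicator of a triple equation over the first and last target coordinates leaves the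
indicator of the second coordinate. [folklore] -/
theorem sum_sum_ite_triple_eq₂ (a₀ : ι') (b₀ : κ') (c₀ : μ') (b' : κ') (r : ℝ) :
    (∑ a' : ι', ∑ c' : μ', if (a₀, b₀, c₀) = (a', b', c') then r else 0) =
      if b₀ = b' then r else 0 := by
  by_cases hb : b₀ = b'
  · simp only [hb, Prod.mk.injEq, true_and, if_true, ite_and, Finset.sum_ite_irrel,
      Finset.sum_ite_eq, Finset.mem_univ, Finset.sum_const_zero]
  · simp [hb]

omit [Fintype μ'] in
/-- Summing an indicator of a triple equation over the first two target coordinates leaves the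
indicator of the third coordinate. [folklore] -/
theorem sum_sum_ite_triple_eq₃ (a₀ : ι') (b₀ : κ') (c₀ : μ') (c' : μ') (r : ℝ) :
    (∑ a' : ι', ∑ b' : κ', if (a₀, b₀, c₀) = (a', b', c') then r else 0) =
      if c₀ = c' then r else 0 := by
  by_cases hc : c₀ = c'
  · simp only [hc, Prod.mk.injEq, and_true, if_true, ite_and, Finset.sum_ite_irrel,
      Finset.sum_ite_eq, Finset.mem_univ, Finset.sum_const_zero]
  · simp [hc]

omit [Fintype ι'] [Fintype κ'] [Fintype μ'] [DecidableEq ι'] [DecidableEq κ'] [DecidableEq μ'] in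
/-- Reordering a sum over triples with the second coordinate outermost. [folklore] -/
theorem sum_prod₃_comm₂ (f : ι × κ × μ → ℝ) : ∑ x, f x = ∑ b, ∑ a, ∑ c, f (a, b, c) := by
  simp only [Fintype.sum_prod_type]
  rw [Finset.sum_comm]

omit [Fintype ι'] [Fintype κ'] [Fintype μ'] [DecidableEq ι'] [DecidableEq κ'] [DecidableEq μ'] in
/-- Reordering a sum over triples with the third coordinate outermost. [folklore] -/
theorem sum_prod₃_comm₃ (f : ι × κ × μ → ℝ) : ∑ x, f x = ∑ c, ∑ a, ∑ b, f (a, b, c) := by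
  simp only [Fintype.sum_prod_type]
  calc (∑ a, ∑ b, ∑ c, f (a, b, c)) = ∑ a, ∑ c, ∑ b, f (a, b, c) :=
      Finset.sum_congr rfl fun a _ => Finset.sum_comm
    _ = ∑ c, ∑ a, ∑ b, f (a, b, c) := Finset.sum_comm

/-- **Transport of `H_θ` along coordinatewise injections** (the final step of the proof of CVZ
Thm. 2.15: "Let `Q(α) = P(φ⁻¹ α)`. Then `H_θ(P) = H_θ(Q)`"): if `φ₁ × φ₂ × φ₃` maps `Φ` into `Ψ` and `φᵢ`
is injective on the `i`-th projection of `Φ`, then `H_θ(Φ) ≤ H_θ(Ψ)` for `θ ≥ 0` — the push-forward of a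
distribution on `Φ` is supported in `Ψ` and has marginals with the same entropies.
[cite: ChristandlVranaZuiddam2023, Thm. 2.15 (proof)] -/
theorem maxWeightedEntropy_le_of_injOn {θ : Fin 3 → ℝ} (hθ : ∀ i, 0 ≤ θ i) {Φ : Set (ι × κ × μ)}
    {Ψ : Set (ι' × κ' × μ')} (φ₁ : ι → ι') (φ₂ : κ → κ') (φ₃ : μ → μ')
    (h₁ : Set.InjOn φ₁ (Prod.fst '' Φ)) (h₂ : Set.InjOn φ₂ ((fun x => x.2.1) '' Φ))
    (h₃ : Set.InjOn φ₃ ((fun x => x.2.2) '' Φ))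
    (hmaps : ∀ x ∈ Φ, (φ₁ x.1, φ₂ x.2.1, φ₃ x.2.2) ∈ Ψ) :
    maxWeightedEntropy θ Φ ≤ maxWeightedEntropy θ Ψ := by
  refine Real.sSup_le ?_ (maxWeightedEntropy_nonneg hθ Ψ)
  rintro _ ⟨P, ⟨hP, hsupp⟩, rfl⟩
  -- the push-forward `P'` of `P` along `φ₁ × φ₂ × φ₃`
  let P' : ι' × κ' × μ' → ℝ := fun z => ∑ x, if (φ₁ x.1, φ₂ x.2.1, φ₃ x.2.2) = z then P x else 0
  have hP'z : ∀ z, P' z = ∑ x, if (φ₁ x.1, φ₂ x.2.1, φ₃ x.2.2) = z then P x else 0 := fun _ => rfl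
  have hP' : P' ∈ stdSimplex ℝ (ι' × κ' × μ') := by
    refine ⟨fun z => Finset.sum_nonneg fun x _ => ?_, ?_⟩
    · show 0 ≤ if (φ₁ x.1, φ₂ x.2.1, φ₃ x.2.2) = z then P x else 0
      split_ifs
      · exact hP.1 x
      · exact le_rfl
    · show ∑ z, ∑ x, (if (φ₁ x.1, φ₂ x.2.1, φ₃ x.2.2) = z then P x else 0) = 1
      rw [Finset.sum_comm]
      simp only [Finset.sum_ite_eq, Finset.mem_univ, if_true]
      exact hP.2
  have hsupp' : Function.support P' ⊆ Ψ := by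
    intro z hz
    obtain ⟨x, -, hx⟩ := Finset.exists_ne_zero_of_sum_ne_zero hz
    by_cases hFx : (φ₁ x.1, φ₂ x.2.1, φ₃ x.2.2) = z
    · rw [if_pos hFx] at hx
      rw [← hFx]
      exact hmaps x (hsupp hx)
    · rw [if_neg hFx] at hx
      exact (hx rfl).elim
  -- the marginals of `P'` are the push-forwards of the marginals of `P`
  have hm₁ : marginalDist₁ P' = fun a' => ∑ a ∈ Finset.univ with φ₁ a = a', marginalDist₁ P a := by
    funext a'
    have L : marginalDist₁ P' a' = ∑ x, if φ₁ x.1 = a' then P x else 0 := by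
      simp only [marginalDist₁, hP'z]
      calc (∑ b' : κ', ∑ c' : μ', ∑ x, if (φ₁ x.1, φ₂ x.2.1, φ₃ x.2.2) = (a', b', c') then P x else 0)
          = ∑ b' : κ', ∑ x, ∑ c' : μ',
              if (φ₁ x.1, φ₂ x.2.1, φ₃ x.2.2) = (a', b', c') then P x else 0 :=
            Finset.sum_congr rfl fun b' _ => Finset.sum_comm
        _ = ∑ x, ∑ b' : κ', ∑ c' : μ',
              if (φ₁ x.1, φ₂ x.2.1, φ₃ x.2.2) = (a', b', c') then P x else 0 := Finset.sum_comm
        _ = ∑ x, if φ₁ x.1 = a' then P x else 0 :=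
            Finset.sum_congr rfl fun x _ => sum_sum_ite_triple_eq₁ _ _ _ _ _
    have R : (∑ a ∈ Finset.univ with φ₁ a = a', marginalDist₁ P a) =
        ∑ x, if φ₁ x.1 = a' then P x else 0 := by
      rw [Finset.sum_filter]
      simp only [marginalDist₁, Fintype.sum_prod_type]
      refine Finset.sum_congr rfl fun a _ => ?_
      split_ifs <;> simp
    rw [L, R]
  have hm₂ : marginalDist₂ P' = fun b' => ∑ b ∈ Finset.univ with φ₂ b = b', marginalDist₂ P b := by
    funext b'
    have L : marginalDist₂ P' b' = ∑ x, if φ₂ x.2.1 = b' then P x else 0 := by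
      simp only [marginalDist₂, hP'z]
      calc (∑ a' : ι', ∑ c' : μ', ∑ x, if (φ₁ x.1, φ₂ x.2.1, φ₃ x.2.2) = (a', b', c') then P x else 0)
          = ∑ a' : ι', ∑ x, ∑ c' : μ',
              if (φ₁ x.1, φ₂ x.2.1, φ₃ x.2.2) = (a', b', c') then P x else 0 :=
            Finset.sum_congr rfl fun a' _ => Finset.sum_comm
        _ = ∑ x, ∑ a' : ι', ∑ c' : μ',
              if (φ₁ x.1, φ₂ x.2.1, φ₃ x.2.2) = (a', b', c') then P x else 0 := Finset.sum_comm
        _ = ∑ x, if φ₂ x.2.1 = b' then P x else 0 :=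
            Finset.sum_congr rfl fun x _ => sum_sum_ite_triple_eq₂ _ _ _ _ _
    have R : (∑ b ∈ Finset.univ with φ₂ b = b', marginalDist₂ P b) =
        ∑ x, if φ₂ x.2.1 = b' then P x else 0 := by
      rw [Finset.sum_filter, sum_prod₃_comm₂]
      simp only [marginalDist₂]
      refine Finset.sum_congr rfl fun b _ => ?_
      split_ifs <;> simp
    rw [L, R]
  have hm₃ : marginalDist₃ P' = fun c' => ∑ c ∈ Finset.univ with φ₃ c = c', marginalDist₃ P c := by
    funext c'
    have L : marginalDist₃ P' c' = ∑ x, if φ₃ x.2.2 = c' then P x else 0 := by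
      simp only [marginalDist₃, hP'z]
      calc (∑ a' : ι', ∑ b' : κ', ∑ x, if (φ₁ x.1, φ₂ x.2.1, φ₃ x.2.2) = (a', b', c') then P x else 0)
          = ∑ a' : ι', ∑ x, ∑ b' : κ',
              if (φ₁ x.1, φ₂ x.2.1, φ₃ x.2.2) = (a', b', c') then P x else 0 :=
            Finset.sum_congr rfl fun a' _ => Finset.sum_comm
        _ = ∑ x, ∑ a' : ι', ∑ b' : κ',
              if (φ₁ x.1, φ₂ x.2.1, φ₃ x.2.2) = (a', b', c') then P x else 0 := Finset.sum_comm
        _ = ∑ x, if φ₃ x.2.2 = c' then P x else 0 :=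
            Finset.sum_congr rfl fun x _ => sum_sum_ite_triple_eq₃ _ _ _ _ _
    have R : (∑ c ∈ Finset.univ with φ₃ c = c', marginalDist₃ P c) =
        ∑ x, if φ₃ x.2.2 = c' then P x else 0 := by
      rw [Finset.sum_filter, sum_prod₃_comm₃]
      simp only [marginalDist₃]
      refine Finset.sum_congr rfl fun c _ => ?_
      split_ifs <;> simp
    rw [L, R]
  -- the projections of the support of `P` lie in the projections of `Φ`
  have hproj : ∀ x, P x ≠ 0 → x ∈ Φ := fun x hx => hsupp hx
  have i₁ : Set.InjOn φ₁ {a | marginalDist₁ P a ≠ 0} := by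
    refine h₁.mono fun a ha => ?_
    obtain ⟨b, -, hb⟩ := Finset.exists_ne_zero_of_sum_ne_zero ha
    obtain ⟨c, -, hc⟩ := Finset.exists_ne_zero_of_sum_ne_zero hb
    exact ⟨(a, b, c), hproj _ hc, rfl⟩
  have i₂ : Set.InjOn φ₂ {b | marginalDist₂ P b ≠ 0} := by
    refine h₂.mono fun b hb => ?_
    obtain ⟨a, -, ha⟩ := Finset.exists_ne_zero_of_sum_ne_zero hb
    obtain ⟨c, -, hc⟩ := Finset.exists_ne_zero_of_sum_ne_zero ha
    exact ⟨(a, b, c), hproj _ hc, rfl⟩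
  have i₃ : Set.InjOn φ₃ {c | marginalDist₃ P c ≠ 0} := by
    refine h₃.mono fun c hc => ?_
    obtain ⟨a, -, ha⟩ := Finset.exists_ne_zero_of_sum_ne_zero hc
    obtain ⟨b, -, hb⟩ := Finset.exists_ne_zero_of_sum_ne_zero ha
    exact ⟨(a, b, c), hproj _ hb, rfl⟩
  have hH : weightedEntropy θ P' = weightedEntropy θ P := by
    simp only [weightedEntropy]
    rw [hm₁, hm₂, hm₃, shannonEntropy_fiberSum_eq _ _ i₁, shannonEntropy_fiberSum_eq _ _ i₂,
      shannonEntropy_fiberSum_eq _ _ i₃]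
  calc weightedEntropy θ P = weightedEntropy θ P' := hH.symm
    _ ≤ maxWeightedEntropy θ Ψ := weightedEntropy_le_maxWeightedEntropy hθ hP' hsupp'

end Transport

end Literature.Computability.AlgebraicComplexity

end
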